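/-
Copyright (c) 2026. All rights reserved.
Released under Apache 2.0 license as described in the file LICENSE.
Authors: abc-iut cell, seat abc-iut-w5-d053 (gen 4; row «COR37-LOGOBS-GLUE», part (b) of abc-iut-L4-t5's
«COR37-COMPAT-LITERAL» split — the glued family and the closer).
-/
import Literature.AnabelianGeometry.AbsoluteAnabelian.AbsTopIII.BiAnabelianLogGlueLaws
import Literature.AnabelianGeometry.AbsoluteAnabelian.AbsTopIII.BiAnabelianObservableProofs
import HarnessLib

/-!
# [AbsTopIII] Cor 3.7 (iii), second clause — the family on `𝒟*` gluing the cores of (i), (ii) with the observable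
# `𝔖†_log`, and `LogObsCompatCoresStmt` under `ι` over Galois

S. Mochizuki, *Topics in absolute anabelian geometry III* [MochizukiAbsTopIII2015] (kurims manuscript
`paper:url-5493eb38cbb7`), Cor 3.7 (iii) p. 88: "[the family of `𝔖†_log`] is compatible with the families of
homotopies that constitute the core and telecore structures of (i), (ii)"; Def 3.5 (ii) p. 75 (compatible =
contained in ONE family); typed by abc-iut-L4-t5 as `BiAnabelianSetting.LogObsCompatCoresStmt`
(`BiAnabelianCompatibility.lean`, p445222): `∃ K, RealisesCoresAndLogObs K`.

This file closes the CORES clause under the two displayed hypotheses (H×), (Hlog) ("`ι_×`, `ι_log` lie over the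
canonical identifications of Galois groups" — the shape of abc-iut-L4-t5's `coresFamily_η_timesGal_app` /
`modelSetting_iotaLog_overGal`; TRUE at the model, p447746):
* `glueLogFamily hT hL` — the family of homotopies on `𝒟*` with boundary set `GlueE` (abc-iut-L4-t12's
  `mkOfStrict` over the laws of `BiAnabelianLogGlueLaws.lean`);
* `glueLogFamily_realises_cores` — it contains core structures on `(𝒟†_{≤4}, 𝔈)`, `(𝒟‡_{≤1}, 𝒳)`, `(𝒟*, 𝔈)`
  (abc-iut-L4-t5's `glueFamily_realises_cores_and_refCore` pattern: all pairs into `𝔈`, resp. `ref`, are glued);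
* `compatibleAlong_embLog_glueLogFamily` — abc-iut-L4-t9 lineage's `𝔖†_log` family `obsFamily` ITSELF
  (`BiAnabelianObservableProofs.lean`) is compatible with it along `embLog : 𝒟†_{≤3} ↪ 𝒟*` (a cell of `E_log` maps to
  a cell pair of `GlueE` with, heterogeneously, the same homotopy), and `isLogObservableFamily_obsFamily`;
* `realisesCoresAndLogObs_glueLogFamily`, the closer **`logObsCompatCoresStmt_of_iotaOverGal (𝔖) (hT) (hL)`**, and
  `glueFamily_sub_glueLogFamily` (abc-iut-L4-t5's `K₁ = glueFamily` is contained in the glued family with the same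
  homotopies — for the sequels: telecore clause, shifts).

HONEST FRAMING: the literal Def 3.5 (ii) clause of Cor 3.7 (iii) is proved here CONDITIONALLY on (H×)/(Hlog)
(displayed hypotheses on `𝔖`, no `Prop` fact; abc-iut-L4-t5 discharges them at the model); the telecore clause
(`LogObsCompatTelecoreStmt`) is abc-iut-L4-t5's part (d).  Bookkeeping over the cell's typing of refereed pre-IUT
material; nothing here bears on [IUTchIII] Cor. 3.12; typed ≠ proved elsewhere.
-/

set_option autoImplicit false

namespace Literature.AnabelianGeometry.AbsoluteAnabelian.AbsTopIII

open CategoryTheory Quiver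
open Literature.AnabelianGeometry.AbsoluteAnabelian.DiagramOfCategories

universe u

namespace BiAnabelianSetting

open StarGlue

variable {X E N : Type u} [Category.{u} X] [Category.{u} E] [Category.{u} N]
  (𝔖 : BiAnabelianSetting X E N)

/-! ### The glued family -/

/-- **The family of homotopies on `𝒟*` gluing the cores with `𝔖†_log`** (boundary set `GlueE`, homotopies
`glueLogη`), under (H×), (Hlog). [cite: MochizukiAbsTopIII2015, Cor 3.7 (iii) p.88] -/
noncomputable def glueLogFamily
    (hT : ∀ y : X, 𝔖.spaceGal.map (𝔖.iotaTimes.app y) = 𝔖.lamTimesGal.hom.app y ≫ 𝔖.lamTimesPfGal.inv.app y)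
    (hL : ∀ A : X, 𝔖.spaceGal.map (𝔖.iotaLog.app A) =
      𝔖.lamTimesGal.hom.app (𝔖.log.obj A) ≫ 𝔖.logGal.hom.app A ≫ 𝔖.lamTimesPfGal.inv.app A) :
    𝔖.starDiagram.HomotopyFamily :=
  HomotopyFamily.mkOfStrict GlueE.{u} isSaturated_glueE (fun _ _ _ _ h => 𝔖.glueLogη h)
    (fun _ _ _ h => 𝔖.glueLogη_refl h) (fun _ _ _ _ _ h₁ h₂ => 𝔖.glueLogη_trans h₁ h₂)
    (fun _ _ _ _ _ _ h r₁ r₂ => 𝔖.glueLogη_whisker hT hL h r₁ r₂)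

section Family

variable (hT : ∀ y : X, 𝔖.spaceGal.map (𝔖.iotaTimes.app y) = 𝔖.lamTimesGal.hom.app y ≫ 𝔖.lamTimesPfGal.inv.app y)
  (hL : ∀ A : X, 𝔖.spaceGal.map (𝔖.iotaLog.app A) =
    𝔖.lamTimesGal.hom.app (𝔖.log.obj A) ≫ 𝔖.logGal.hom.app A ≫ 𝔖.lamTimesPfGal.inv.app A)

/-- Its boundary set is `GlueE` (definitional). [cite: MochizukiAbsTopIII2015, Cor 3.7 (iii) p.88] -/
theorem glueLogFamily_E_iff {a b : Cor37Vertex} (P Q : StarPath.{u} a b) :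
    (𝔖.glueLogFamily hT hL).E P Q ↔ GlueE P Q := Iff.rfl

/-- Its homotopies are `glueLogη`, re-typed to the path functors of `DiagramsOfCategories.lean` (definitional).
[cite: MochizukiAbsTopIII2015, Cor 3.7 (iii) p.88] -/
theorem glueLogFamily_η {a b : Cor37Vertex} {P Q : StarPath.{u} a b} (h : GlueE P Q) :
    (𝔖.glueLogFamily hT hL).η h = eqToHom (pathFunctor_eq_pathFunctor' _ P) ≫ 𝔖.glueLogη h ≫
      eqToHom (pathFunctor_eq_pathFunctor' _ Q).symm := rfl

/-! ### The cores of (i), (ii) -/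

/-- **The glued family contains the `𝔈`-core of `𝒟†_{≤4}`, the `𝒳`-core of `𝒟‡_{≤1}` and the `𝔈`-core of `𝒟*`**
(abc-iut-L4-t5's `glueFamily_realises_cores_and_refCore` pattern: every co-verticial pair into `𝔈` is glued
(`GlueE.gal`), every one into `𝒳` is glued (`GlueE.tailEq _ _ nil`), and the pulled-back families are compatible
along the embeddings by construction). [cite: MochizukiAbsTopIII2015, Cor 3.7 (iii) p.88] -/
theorem glueLogFamily_realises_cores :
    (∃ H hH, (𝔖.galCoreObs H hH).IsCore ∧ H.CompatibleAlong embGalCore (𝔖.glueLogFamily hT hL)) ∧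
    (∃ H hH, (𝔖.refCoreObs H hH).IsCore ∧ H.CompatibleAlong embRefCore (𝔖.glueLogFamily hT hL)) ∧
    (∃ H hH, (𝔖.starGalCoreObs H hH).IsCore ∧ H.CompatibleAlong embStarCore (𝔖.glueLogFamily hT hL)) := by
  refine ⟨⟨(𝔖.pullGalCore (𝔖.glueLogFamily hT hL)).endingAt _ isEmpty_hom_galCoreObs, fun _ _ _ _ h => h.1,
      ⟨fun _ p q => ⟨rfl, (𝔖.pullGalCore_E_iff _ p q).mpr (GlueE.gal _ _)⟩, galCore_reaches⟩,
      HomotopyFamily.endingAt_compatibleAlong _ _ _ (𝔖.pullGalCore_compatibleAlong _) _ _⟩,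
    ⟨(𝔖.pullRefCore (𝔖.glueLogFamily hT hL)).endingAt _ isEmpty_hom_refCoreObs, fun _ _ _ _ h => h.1,
      ⟨fun _ p q => ⟨rfl, (𝔖.pullRefCore_E_iff _ p q).mpr (GlueE.tailEq _ _ Path.nil rfl)⟩, refCore_reaches⟩,
      HomotopyFamily.endingAt_compatibleAlong _ _ _ (𝔖.pullRefCore_compatibleAlong _) _ _⟩,
    ⟨(𝔖.pullStarCore (𝔖.glueLogFamily hT hL)).endingAt _ isEmpty_hom_starCoreObs, fun _ _ _ _ h => h.1,
      ⟨fun _ p q => ⟨rfl, (𝔖.pullStarCore_E_iff _ p q).mpr (GlueE.gal _ _)⟩, starGalCore_reaches⟩,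
      HomotopyFamily.endingAt_compatibleAlong _ _ _ (𝔖.pullStarCore_compatibleAlong _) _ _⟩⟩

end Family

/-! ### The cells of `𝔖†_log` read on `𝒟*` along `embLog` -/

/-- The cell of `𝒟*` that is the image along `embLog : 𝒟†_{≤3} ↪ 𝒟*` of a cell of `E_log` (abc-iut-L4-t9 lineage's
`ObsCell`). [cite: MochizukiAbsTopIII2015, Cor 3.7 (iii) p.88] -/
def starCellOf {a : logObsShape.{u}.Vertex} : ObsCell.{u} a lvObs.{u} → StarCell.{u} (embLog.{u}.obj a)
  | .refl r e => .refl (embLog.mapPath r) (embLog.map e)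
  | .times r => .times (embLog.mapPath r)
  | .log n r => .log n (embLog.mapPath r)

/-- The image of the left path of a cell is the left path of its image. [cite: MochizukiAbsTopIII2015, Cor 3.7 (iii) p.88] -/
theorem starCellOf_left {a : logObsShape.{u}.Vertex} (g : ObsCell.{u} a lvObs.{u}) :
    embLog.mapPath g.left = (starCellOf g).left := by
  cases g <;> rfl

/-- The image of the right path of a cell is the right path of its image. [cite: MochizukiAbsTopIII2015, Cor 3.7 (iii) p.88] -/
theorem starCellOf_right {a : logObsShape.{u}.Vertex} (g : ObsCell.{u} a lvObs.{u}) :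
    embLog.mapPath g.right = (starCellOf g).right := by
  cases g <;> rfl

/-- `embLog` avoids the reference vertex (`𝒟†` has no vertex `ref`). [cite: MochizukiAbsTopIII2015, Cor 3.7 (iii) p.88] -/
theorem embLog_obj_ne_ref (c : logObsShape.{u}.Vertex) : embLog.{u}.obj c ≠ Cor37Vertex.ref := by
  rcases c with ⟨v, hv⟩ | _
  · exact hv.1
  · intro h; cases h

/-- Images of `𝒟†_{≤3}`-paths never visit `ref`. [cite: MochizukiAbsTopIII2015, Cor 3.7 (iii) p.88] -/
theorem refCount_mapPath_embLog {c d : logObsShape.{u}.Vertex} (p : Path c d) :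
    refCount (embLog.{u}.mapPath p) = 0 := by
  induction p with
  | nil => rfl
  | cons p e ih => rw [Prefunctor.mapPath_cons, refCount_cons, ih, if_neg (embLog_obj_ne_ref _)]

/-- Images of `𝒟†_{≤3}`-paths do not visit `ref`. [cite: MochizukiAbsTopIII2015, Cor 3.7 (iii) p.88] -/
theorem not_visitsRef_mapPath_embLog {c d : logObsShape.{u}.Vertex} (p : Path c d) :
    ¬ VisitsRef (embLog.{u}.mapPath p) :=
  (not_visitsRef_iff _).2 ⟨embLog_obj_ne_ref c, refCount_mapPath_embLog p⟩

/-- Along `embLog` the structural path functors of `𝒟†_{≤3}` (presentation `logObsDiagram`) and of `𝒟*` agree.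
[cite: MochizukiAbsTopIII2015, Cor 3.7 (iii) p.88] -/
theorem heq_pathFunctor'_embLog : ∀ {c d : logObsShape.{u}.Vertex} (p : Path c d),
    HEq (𝔖.logObsDiagram.pathFunctor' p) (𝔖.starDiagram.pathFunctor' (embLog.{u}.mapPath p)) := by
  intro c d p
  induction p with
  | nil => rcases c with ⟨_ | _ | _ | _ | _, _⟩ | _ <;> exact HEq.rfl
  | cons p e ih =>
    rename_i d' d
    rw [pathFunctor'_cons, Prefunctor.mapPath_cons, pathFunctor'_cons]
    revert ih e
    rcases c with ⟨_ | _ | _ | _ | _, _⟩ | _ <;> rcases d' with ⟨_ | _ | _ | _ | _, _⟩ | _ <;>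
      rcases d with _ | _ <;> intro e ih <;>
      first
        | exact (PEmpty.elim e)
        | (rw [eq_of_heq ih]; rfl)
        | (rcases e with ⟨_ | _⟩ <;> (rw [eq_of_heq ih]; rfl))

/-- abc-iut-L4-t9 lineage's transported cell homotopy `cellT` is heterogeneously the cell homotopy.
[cite: MochizukiAbsTopIII2015, Cor 3.7 (iii) p.88] -/
theorem cellT_heq_cell {a b : logObsShape.{u}.Vertex} (g : ObsCell.{u} a b) {p q : Path a b} (hp : p = g.left)
    (hq : q = g.right) : HEq (𝔖.cellT g hp hq) (𝔖.cell g) := by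
  subst hp hq
  exact HomotopyFamily.heq_eqToHom_comp_comp_eqToHom _ _ _

/-- **The homotopy of a cell of `𝔖†_log` IS the cell homotopy of its image on `𝒟*`** (heterogeneously; the path
functors agree along `embLog`). [cite: MochizukiAbsTopIII2015, Cor 3.7 (iii) p.88] -/
theorem cell_heq_cellη {c : logObsShape.{u}.Vertex} (g : ObsCell.{u} c lvObs.{u}) :
    HEq (𝔖.cell g) (𝔖.cellη (starCellOf g)) := by
  have hp : ∀ {d : logObsShape.{u}.Vertex} (p : Path c d),
      HEq (𝔖.logObsDiagram.pathFunctor' p) (𝔖.starDiagram.pathFunctor' (embLog.{u}.mapPath p)) :=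
    fun p => 𝔖.heq_pathFunctor'_embLog p
  rcases c with ⟨v, hv⟩ | _
  · cases g with
    | refl r e => exact id_heq_id (eq_of_heq (hp (r.cons e)))
    | times r => exact whiskerLeft_heq (eq_of_heq (hp r)) rfl rfl HEq.rfl
    | log n r => exact whiskerLeft_heq (eq_of_heq (hp r)) rfl rfl HEq.rfl
  · cases g with
    | refl r e => exact id_heq_id (eq_of_heq (hp (r.cons e)))
    | times r => exact whiskerLeft_heq (eq_of_heq (hp r)) rfl rfl HEq.rfl
    | log n r => exact whiskerLeft_heq (eq_of_heq (hp r)) rfl rfl HEq.rfl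

/-! ### `𝔖†_log` is compatible with the glued family; the closer -/

/-- abc-iut-L4-t9 lineage's `obsFamily` IS the `𝔖†_log` family (generated by `LogGen`, boundary paths end at `𝒩`,
`ι_×`/`ι_{log,⋎}` pinned on the generators — the three clauses of `observableLogStmt_holds`, restated for the
witness). [cite: MochizukiAbsTopIII2015, Cor 3.7 (iii) p.88] -/
theorem isLogObservableFamily_obsFamily : 𝔖.IsLogObservableFamily 𝔖.obsFamily := by
  refine ⟨fun a b p q => obsRel_iff_saturation p q, fun a b p q h => ?_, ?_, ?_⟩
  · obtain ⟨g, -, -⟩ := ObsRel.out h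
    exact g.eq_obs
  · refine ⟨ObsRel.mk (ObsCell.times Path.nil), fun x e₁ e₂ => ?_⟩
    rw [obsFamily_η, 𝔖.obsEta_eq (p := timesPairLeft.{u}) (q := timesPairRight.{u}) _
      (ObsCell.times Path.nil) rfl rfl]
    simp only [cellT, cell, NatTrans.comp_app, eqToHom_app, Functor.whiskerLeft_app, eqToHom_trans,
      eqToHom_trans_assoc, Category.assoc]
    rfl
  · intro n
    refine ⟨ObsRel.mk (ObsCell.log n Path.nil), fun o e₁ e₂ => ?_⟩
    rw [obsFamily_η, 𝔖.obsEta_eq (p := logPairLeft.{u} n) (q := logPairRight.{u} n) _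
      (ObsCell.log n Path.nil) rfl rfl]
    simp only [cellT, cell, NatTrans.comp_app, eqToHom_app, Functor.whiskerLeft_app, eqToHom_trans,
      eqToHom_trans_assoc, Category.assoc]
    rfl

section Closer

variable (hT : ∀ y : X, 𝔖.spaceGal.map (𝔖.iotaTimes.app y) = 𝔖.lamTimesGal.hom.app y ≫ 𝔖.lamTimesPfGal.inv.app y)
  (hL : ∀ A : X, 𝔖.spaceGal.map (𝔖.iotaLog.app A) =
    𝔖.lamTimesGal.hom.app (𝔖.log.obj A) ≫ 𝔖.logGal.hom.app A ≫ 𝔖.lamTimesPfGal.inv.app A)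

/-- **The `𝔖†_log` family is compatible with the glued family along `embLog : 𝒟†_{≤3} ↪ 𝒟*`** (Def 3.5 (ii):
`E_log ⊆ E` and the same homotopies, heterogeneously): a pair of `E_log` is a cell pair, its image is the cell pair
of the image cell (never visiting `ref`), and both homotopies are the cell homotopy.
[cite: MochizukiAbsTopIII2015, Cor 3.7 (iii) p.88] -/
theorem compatibleAlong_embLog_glueLogFamily :
    𝔖.obsFamily.CompatibleAlong embLog.{u} (𝔖.glueLogFamily hT hL) := by
  intro c d p q h
  obtain ⟨g, rfl, rfl⟩ := h.out
  obtain rfl := g.eq_obs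
  have hE : GlueE (embLog.{u}.mapPath g.left) (embLog.{u}.mapPath g.right) := by
    rw [starCellOf_left, starCellOf_right]
    exact GlueE.cell _ (by rw [← starCellOf_left]; exact not_visitsRef_mapPath_embLog _)
  refine ⟨hE, ?_⟩
  have hv : ¬ VisitsRef (starCellOf g).left := by
    rw [← starCellOf_left]; exact not_visitsRef_mapPath_embLog _
  rw [obsFamily_η, 𝔖.obsEta_eq h g rfl rfl, glueLogFamily_η,
    𝔖.glueLogη_eq_val hE (by intro h'; cases h')
      (GlueDec.cell (starCellOf g) hv (starCellOf_left g) (starCellOf_right g))]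
  refine ((HomotopyFamily.heq_eqToHom_comp_comp_eqToHom _ _ _).trans (𝔖.cellT_heq_cell g rfl rfl)).trans
    ((𝔖.cell_heq_cellη g).trans ?_)
  exact ((HomotopyFamily.heq_eqToHom_comp_comp_eqToHom _ _ _).trans
    (𝔖.val_cell_heq (starCellOf g) hv (starCellOf_left g) (starCellOf_right g))).symm

/-- **The glued family realises the cores of (i), (ii) AND the observable `𝔖†_log`** (`RealisesCoresAndLogObs`).
[cite: MochizukiAbsTopIII2015, Cor 3.7 (iii) p.88] -/
theorem realisesCoresAndLogObs_glueLogFamily : 𝔖.RealisesCoresAndLogObs (𝔖.glueLogFamily hT hL) :=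
  ⟨⟨𝔖.obsFamily, 𝔖.isLogObservableFamily_obsFamily, 𝔖.compatibleAlong_embLog_glueLogFamily hT hL⟩,
    𝔖.glueLogFamily_realises_cores hT hL⟩

/-- **abc-iut-L4-t5's glue family `K₁` (`glueFamily`: pairs through `𝔈` or `𝒳`) is contained in the glued family**
with the same homotopies (Def 3.5 (ii): `E_{K₁} ⊆ E`, `ζ^{K₁}_ϖ = ζ_ϖ`) — so everything realised by `K₁`
(p446969) is realised by `glueLogFamily`, for the sequels (telecore clause, shifts).
[cite: MochizukiAbsTopIII2015, Cor 3.7 (iii) p.88] -/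
theorem glueFamily_sub_glueLogFamily {a b : Cor37Vertex} {P Q : StarPath.{u} a b} (h : 𝔖.glueFamily.E P Q) :
    ∃ h' : (𝔖.glueLogFamily hT hL).E P Q, 𝔖.glueFamily.η h = (𝔖.glueLogFamily hT hL).η h' := by
  by_cases hb : b = Cor37Vertex.galois
  · subst hb
    have hK : 𝔖.coresFamily.E P Q := (𝔖.coresFamily_E_iff P Q).2 rfl
    refine ⟨GlueE.gal P Q, ?_⟩
    rw [show 𝔖.glueFamily.η h = 𝔖.glueη h from rfl, 𝔖.glueη_of_E h hK, glueLogFamily_η,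
      𝔖.glueLogη_of_galois _ hK]
    simp
  · obtain ⟨p, q, s, rfl, rfl⟩ := exists_through_ref_of_univE₂ h hb
    obtain ⟨p', q', t, ht, e₁, e₂⟩ := exists_glueDec_reroute p q s
    refine ⟨(GlueDec.reroute p' q' t ht e₁ e₂).glueE, ?_⟩
    rw [show 𝔖.glueFamily.η h = 𝔖.glueη h from rfl, 𝔖.glueη_of_not h hb, glueLogFamily_η,
      𝔖.glueLogη_eq_val _ hb (GlueDec.reroute p' q' t ht e₁ e₂), val_reroute, eqToHom_trans, eqToHom_trans]

end Closer

/-- **[AbsTopIII] Cor 3.7 (iii), second clause — cores part (`LogObsCompatCoresStmt`), under `ι` over Galois**: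
if `ι_×` and `ι_log` lie over the canonical identifications of Galois groups ((H×), (Hlog) — the shapes of
abc-iut-L4-t5's `coresFamily_η_timesGal_app` / `coresFamily_η_logGal_app`; TRUE at the model, p447746), then ONE
family of homotopies on `𝒟*` contains the `𝔖†_log` family of (iii) and the core structures of (i), (ii).
[cite: MochizukiAbsTopIII2015, Cor 3.7 (iii) p.88] -/
theorem logObsCompatCoresStmt_of_iotaOverGal
    (hT : ∀ y : X, 𝔖.spaceGal.map (𝔖.iotaTimes.app y) = 𝔖.lamTimesGal.hom.app y ≫ 𝔖.lamTimesPfGal.inv.app y)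
    (hL : ∀ A : X, 𝔖.spaceGal.map (𝔖.iotaLog.app A) =
      𝔖.lamTimesGal.hom.app (𝔖.log.obj A) ≫ 𝔖.logGal.hom.app A ≫ 𝔖.lamTimesPfGal.inv.app A) :
    Literature.AnabelianGeometry.AbsoluteAnabelian.AbsTopIII.BiAnabelianSetting.LogObsCompatCoresStmt 𝔖 :=
  ⟨𝔖.glueLogFamily hT hL, 𝔖.realisesCoresAndLogObs_glueLogFamily hT hL⟩

end BiAnabelianSetting

end Literature.AnabelianGeometry.AbsoluteAnabelian.AbsTopIII
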